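import Mathlib
import HarnessLib
import Literature.AlgebraicGeometry.Ramification.InertiaNormalSylow
import Literature.AlgebraicGeometry.GroupActions.KollarSzaboGoingDown
import Literature.NumberTheory.EllipticCurves.NeronModelCodimOne
import Summits.ResolutionOfSingularities.ResolutionOfSingularities.Theorems.WildQuotientsWildQuotientResolutionKSGoingDownOfStep

/-!
# Kollár–Szabó going down: the case `dim 𝒪_{X,x} ≤ 1` unconditionally, and `Spec`-level tools for
# the blow-up step (crux `WildQuotients.WildQuotientResolution`, stub `stub_phaseZeroHighDim`)

Crux stmt-ResolutionOfSingularities-15640 (`WildQuotientResolution`), registered stub `stub_phaseZeroHighDim`;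
programme: discharge the named fact `Literature.AlgebraicGeometry.GroupActions.KollarSzaboGoingDown` (hand 8-g0
memo PHASE0-KS-EIGENLINE.md). ✓`kollarSzaboGoingDown_of_step` (p828172) reduces the fact to the abstract
equivariant point-blow-up step `hstep`; the LOCAL chart `X̃ = Spec S[𝔪/t] → Spec S = Spec 𝒪_{X,x} → X`
(`t` an `H`-eigen-parameter, ✓`AbelianEigenlineStalk`), `η = (t)`, `E = Spec (S[𝔪/t]/t)`, `x₁` = the
`H`-fixed maximal ideal of the chart (hand 8-g1, (K2)) is a legitimate instance of `hstep` — no global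
blow-up or projective space is needed. This file supplies

* `kollarSzaboGoingDown_of_valuationRing_stalk`, `kollarSzaboGoingDown_of_ringKrullDim_le_one` — the
  conclusion of the named fact UNCONDITIONALLY when `𝒪_{X,x}` is a valuation ring, in particular when
  `dim 𝒪_{X,x} ≤ 1` (curves; regular of dimension `1` = discrete valuation ring): no blow-up is needed,
  `x` itself lies in the stable domain of definition.
* `Spec`-level adapters for assembling `hstep` from ring-level data, in the tree's `specAction`
  convention `ρ g = Spec (g⁻¹)` (✓`AffineQuotient.exists_specAction`):
  `specMap_comm_of_equivariant` (an equivariant ring map gives equivariant `Spec` maps),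
  `mem_inertiaSubgroup_specMap_of_invariant` (a `g`-invariant ring map `φ : B → K` to a field puts `g`
  in the inertia group of the point `ker φ`), `isDominant_specMap_comp_fromSpecStalk` (for `X`
  integral and `𝒪_{X,x} ↪ T` injective into a domain, `Spec T → Spec 𝒪_{X,x} → X` is dominant),
  `valuationRing_of_ringEquiv` (transport of the valuation-ring property).

[OURS · crux stmt-ResolutionOfSingularities-15640 · helper toward `stub_phaseZeroHighDim` (partial discharge
of a named fact + adapters; NOT a proof of the stub); counted 0; AI-level work, weaker than expert review.]
[cite: ReichsteinYoussin2000, Appendix (Kollár–Szabó), Prop. A.2]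
-/

-- single-problem summit: the doubled namespace component `ResolutionOfSingularities` is forced
set_option linter.dupNamespace false

noncomputable section

open CategoryTheory CategoryTheory.Limits AlgebraicGeometry TopologicalSpace IsLocalRing
open Literature.AlgebraicGeometry.Ramification Literature.AlgebraicGeometry.Resolution
open Literature.AlgebraicGeometry.Morphisms

namespace Summit.ResolutionOfSingularities.ResolutionOfSingularities.Theorems.WildQuotientResolution.KSGoingDown

universe u v

/-! ## The named fact when `𝒪_{X,x}` is a valuation ring (no blow-up) -/

/-- **Kollár–Szabó going down when `𝒪_{X,x}` is a valuation ring, unconditionally** (binders of the named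
fact `KollarSzaboGoingDown` with regularity replaced by `ValuationRing 𝒪_{X,x}`): the equivariant inverse
section of `π` over the stable open `⋂_h σ_h⁻¹(U)` extends equivariantly across `x`
(✓`goingDown_of_valuationRing`). [cite: ReichsteinYoussin2000, Appendix, Prop. A.2] -/
theorem kollarSzaboGoingDown_of_valuationRing_stalk
    (K : Type) [Field K] (X Y : Scheme.{0}) (sX : X ⟶ Spec (.of K)) [IsSeparated sX]
    [LocallyOfFiniteType sX] [QuasiCompact sX] [IsIntegral X] [IsIntegral Y] (π : Y ⟶ X)
    [IsProper (π ≫ sX)] (hbir : IsBirational π) (H : Type) [Group H] [Finite H]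
    (σ : H →* Aut X) (τ : H →* Aut Y) (hτ : ∀ h : H, (τ h).hom ≫ π = π ≫ (σ h).hom)
    (x : X) (hval : ValuationRing (X.presheaf.stalk x)) (hfix : ∀ h : H, h ∈ inertiaSubgroup σ x) :
    ∃ y : Y, ∀ h : H, h ∈ inertiaSubgroup τ y := by
  obtain ⟨U, hUd, -, hUiso⟩ := hbir
  let W : X.Opens := ⟨⋂ h : H, (((σ h).hom ⁻¹ᵁ U : X.Opens) : Set X),
    isOpen_iInter_of_finite fun h => ((σ h).hom ⁻¹ᵁ U).2⟩
  have hWst : ∀ g, (σ g).hom ⁻¹ᵁ W = W := preimage_iInter_stable σ U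
  have hWU : W ≤ U := by
    intro z hz
    have h1 := Set.mem_iInter.mp hz 1
    rwa [map_one] at h1
  have hWne : (W : Set X).Nonempty := ⟨genericPoint X, genericPoint_mem_iInter σ U hUd.nonempty⟩
  haveI : IsIso (π ∣_ W) := isIso_morphismRestrict_of_le π hWU
  let s : (W : Scheme.{0}) ⟶ Y := inv (π ∣_ W) ≫ (π ⁻¹ᵁ W).ι
  have hs : s ≫ (π ≫ sX) = W.ι ≫ sX := by
    rw [← Category.assoc, inv_morphismRestrict_comp π]
  have hseq : ∀ h, (σ h).hom.resLE W W (hWst h).ge ≫ s = s ≫ (τ h).hom :=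
    inv_morphismRestrict_equivariant σ τ π hτ hWst
  haveI : Y.IsSeparated := by
    constructor
    rw [show terminal.from Y = (π ≫ sX) ≫ terminal.from _ from terminal.hom_ext _ _]
    infer_instance
  exact goingDown_of_valuationRing X sX σ x hval hfix Y (π ≫ sX) τ W hWne hWst s hs hseq

/-- **Kollár–Szabó going down for `dim 𝒪_{X,x} ≤ 1`, unconditionally** (the named fact's binders plus
`ringKrullDim 𝒪_{X,x} ≤ 1`; e.g. `X` a curve): a regular local ring of dimension `≤ 1` is a field or a
discrete valuation ring, hence a valuation ring. [cite: ReichsteinYoussin2000, Appendix, Prop. A.2] -/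
theorem kollarSzaboGoingDown_of_ringKrullDim_le_one
    (K : Type) [Field K] (X Y : Scheme.{0}) (sX : X ⟶ Spec (.of K)) [IsSeparated sX]
    [LocallyOfFiniteType sX] [QuasiCompact sX] [IsIntegral X] [IsIntegral Y] (π : Y ⟶ X)
    [IsProper (π ≫ sX)] (hbir : IsBirational π) (H : Type) [Group H] [Finite H]
    (σ : H →* Aut X) (τ : H →* Aut Y) (hτ : ∀ h : H, (τ h).hom ≫ π = π ≫ (σ h).hom)
    (x : X) (hreg : IsRegularLocalRing (X.presheaf.stalk x))
    (hdim : ringKrullDim (X.presheaf.stalk x) ≤ 1) (hfix : ∀ h : H, h ∈ inertiaSubgroup σ x) :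
    ∃ y : Y, ∀ h : H, h ∈ inertiaSubgroup τ y := by
  haveI := hreg
  have hval : ValuationRing (X.presheaf.stalk x) := by
    obtain ⟨n, hn⟩ := Literature.AlgebraicGeometry.Resolution.ringKrullDim_eq_nat (X.presheaf.stalk x)
    by_cases h0 : n = 0
    · subst h0
      exact valuationRing_of_isRegularLocalRing_of_ringKrullDim_le_zero _ hn.le
    · have hn1 : n = 1 := by
        have : (n : WithBot ℕ∞) ≤ 1 := hn ▸ hdim
        have : n ≤ 1 := by exact_mod_cast this
        omega
      subst hn1
      haveI := Literature.NumberTheory.EllipticCurves.isDiscreteValuationRing_of_isRegularLocalRing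
        (X.presheaf.stalk x) hn
      infer_instance
  exact kollarSzaboGoingDown_of_valuationRing_stalk K X Y sX π hbir H σ τ hτ x hval hfix

/-! ## `Spec`-level adapters (convention `ρ g = Spec (g⁻¹)`) -/

section SpecTools

variable {A B : Type u} [CommRing A] [CommRing B] {G : Type v} [Group G]
  [MulSemiringAction G A] [MulSemiringAction G B]

/-- **Equivariant ring maps give equivariant `Spec` maps**: if `f (g • a) = g • f a` then
`ρ_B g ≫ Spec f = Spec f ≫ ρ_A g` for the actions `ρ g = Spec (g⁻¹)` on `Spec A`, `Spec B`. [folklore] -/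
theorem specMap_comm_of_equivariant (ρA : G →* Aut (Spec (.of A)))
    (hρA : ∀ g, (ρA g).hom =
      Spec.map (CommRingCat.ofHom ((MulSemiringAction.toRingEquiv G A g⁻¹ : A ≃+* A) : A →+* A)))
    (ρB : G →* Aut (Spec (.of B)))
    (hρB : ∀ g, (ρB g).hom =
      Spec.map (CommRingCat.ofHom ((MulSemiringAction.toRingEquiv G B g⁻¹ : B ≃+* B) : B →+* B)))
    (f : A →+* B) (hf : ∀ (g : G) (a : A), f (g • a) = g • f a) (g : G) :
    (ρB g).hom ≫ Spec.map (CommRingCat.ofHom f) = Spec.map (CommRingCat.ofHom f) ≫ (ρA g).hom := by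
  rw [hρA, hρB, ← Spec.map_comp, ← Spec.map_comp, ← CommRingCat.ofHom_comp, ← CommRingCat.ofHom_comp]
  congr 2
  refine RingHom.ext fun a => ?_
  simp only [RingHom.coe_comp, RingHom.coe_coe, Function.comp_apply,
    MulSemiringAction.toRingEquiv_apply_apply]
  exact (hf g⁻¹ a).symm

omit [MulSemiringAction G A] in
/-- **Inertia on `Spec B` from an invariant ring map to a field**: if `φ : B → K` (`K` a field)
satisfies `φ (g • b) = φ b` for all `b`, then `g` lies in the inertia group (AS2011 2.4) of the point
`ker φ ∈ Spec B` — the image of the closed point of `Spec K` — for `ρ g = Spec (g⁻¹)`. [folklore] -/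
theorem mem_inertiaSubgroup_specMap_of_invariant (ρB : G →* Aut (Spec (.of B)))
    (hρB : ∀ g, (ρB g).hom =
      Spec.map (CommRingCat.ofHom ((MulSemiringAction.toRingEquiv G B g⁻¹ : B ≃+* B) : B →+* B)))
    {K : Type u} [Field K] (φ : B →+* K) (g : G) (hφ : ∀ b : B, φ (g • b) = φ b) :
    g ∈ inertiaSubgroup ρB ((Spec.map (CommRingCat.ofHom φ)).base (closedPoint K)) := by
  refine (mem_inertiaSubgroup_iff_comp_eq ρB (Spec.map (CommRingCat.ofHom φ)) g).mpr ?_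
  rw [hρB, ← Spec.map_comp, ← CommRingCat.ofHom_comp]
  congr 2
  refine RingHom.ext fun b => ?_
  simp only [RingHom.coe_comp, RingHom.coe_coe, Function.comp_apply,
    MulSemiringAction.toRingEquiv_apply_apply]
  have h := hφ (g⁻¹ • b)
  rw [smul_inv_smul] at h
  exact h.symm

/-- The point `ker φ`: the image of the closed point of `Spec K` under `Spec φ` has `asIdeal = ker φ`.
[folklore] -/
theorem specMap_base_closedPoint_asIdeal {K : Type u} [Field K] (φ : B →+* K) :
    ((Spec.map (CommRingCat.ofHom φ)).base (closedPoint K)).asIdeal = RingHom.ker φ := by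
  change Ideal.comap φ (maximalIdeal K) = RingHom.ker φ
  rw [show maximalIdeal K = ⊥ from (isField_iff_maximalIdeal_eq).mp (Field.toIsField K)]
  rfl

/-- **Transport of the valuation-ring property along a ring isomorphism.** [folklore] -/
theorem valuationRing_of_ringEquiv {R S : Type*} [CommRing R] [IsDomain R] [CommRing S] [IsDomain S]
    (e : R ≃+* S) [hR : ValuationRing R] : ValuationRing S := by
  have hpre : PreValuationRing S := by
    refine ⟨fun a b => ?_⟩
    obtain ⟨c, hc⟩ := PreValuationRing.cond' (e.symm a) (e.symm b)
    refine ⟨e c, ?_⟩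
    rcases hc with hc | hc
    · left
      have := congrArg e hc
      simpa using this
    · right
      have := congrArg e hc
      simpa using this
  exact ⟨⟩

/-- **`Spec T → Spec 𝒪_{X,x} → X` is dominant** for `X` integral and `𝒪_{X,x} → T` an injective ring map
into a domain (e.g. a blow-up chart `T = 𝒪_{X,x}[𝔪/t] ⊆ K(X)`). [folklore] -/
theorem isDominant_specMap_comp_fromSpecStalk {X : Scheme.{u}} [IsIntegral X] (x : X)
    {T : CommRingCat.{u}} [IsDomain T] (f : X.presheaf.stalk x ⟶ T)
    (hf : Function.Injective f.hom) : IsDominant (Spec.map f ≫ X.fromSpecStalk x) := by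
  haveI : IsDominant (Spec.map f) := by
    constructor
    change DenseRange (PrimeSpectrum.comap f.hom)
    rw [PrimeSpectrum.denseRange_comap_iff_ker_le_nilRadical]
    intro a ha
    rw [RingHom.mem_ker] at ha
    have : a = 0 := hf (by rw [ha, map_zero])
    rw [this]
    exact zero_mem _
  haveI : IsDominant (X.fromSpecStalk x) := by
    constructor
    have hgen : genericPoint X ∈ Set.range (X.fromSpecStalk x).base := by
      rw [Scheme.range_fromSpecStalk]
      exact genericPoint_specializes x
    obtain ⟨p, hp⟩ := hgen
    refine Dense.mono (Set.range_comp_subset_range (fun _ : Unit => p) _) ?_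
    rw [Set.range_comp, Set.range_const, Set.image_singleton, hp]
    exact dense_iff_closure_eq.mpr (genericPoint_spec X)
  infer_instance


/-- **The local ring of `Spec A` at `x` is a valuation ring when `A_𝔭ₓ` is** (transport along the
canonical identification of the stalk with the localisation; e.g. `x = (t)` the exceptional prime of a
quadratic transform, ✓`valuationRing_localization_span_singleton`). [folklore] -/
theorem valuationRing_stalk_spec {R : Type u} [CommRing R] [IsDomain R] (x : Spec (CommRingCat.of R))
    [ValuationRing (Localization.AtPrime x.asIdeal)] :
    ValuationRing ((Spec (CommRingCat.of R)).presheaf.stalk x) :=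
  valuationRing_of_ringEquiv
    (IsLocalization.algEquiv x.asIdeal.primeCompl (Localization.AtPrime x.asIdeal)
      ((Spec.structureSheaf R).presheaf.stalk x)).toRingEquiv

end SpecTools

end Summit.ResolutionOfSingularities.ResolutionOfSingularities.Theorems.WildQuotientResolution.KSGoingDown

end
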